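import Summits.NavierStokesRegularity.NavierStokesRegularity.Theorems.ClockStretchingLawClockCeilingOpenSetVorticityLiouville
import Literature.Analysis.FluidPDE.TypeIAncientMild
import HarnessLib

/-!
# Route ClockStretchingLaw, crux `ClockCeiling` (stmt-NavierStokesRegularity-10570),
# line `registered` — portrait clause: no element of the Type-I ancient mild class is
# LOCALLY STEADY

`stub_openSetSteadyLiouville`: if `u` is an element of the Type-I ancient mild class
(`IsTypeIAncientMild C u`: jointly smooth on `t < 0`, divergence free, KNSS/Oseen mild between all
pairs `s < t < 0`, `‖u(t,x)‖ ≤ C/√(−t)`) and the clock mode `∂ₜu(t₀, ·)` of ONE slice (`t₀ < 0`)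
vanishes on a nonempty open set `U ⊆ ℝ³`, then `u ≡ 0` on the whole open slab `t < 0`.

## Proof

1. *Joint analyticity.* `uncurry u` is jointly real-analytic on the open slab
   `(−∞,0) × ℝ³` (`openSetLiouville_analyticOnNhd_uncurry`: Lemarié-Rieusset 2016 Thm. 9.12 +
   uniqueness of bounded Oseen-mild solutions).
2. *The clock mode is jointly analytic.* On the open slab `∂ₜu(t,x) = D(uncurry u)(t,x)(1,0)`
   (chain rule along the line `s ↦ (s, x)`), and the Fréchet derivative of an analytic map is
   analytic (`AnalyticOnNhd.fderiv`), as is its value on the fixed vector `(1,0)`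
   (`openSetSteadyLiouville_analyticOnNhd_uncurry_timeDeriv`); hence every slice `∂ₜu(t₀, ·)` is
   real-analytic on `ℝ³` (`analyticOnNhd_slice`).
3. *Identity theorem in space.* `∂ₜu(t₀, ·)` vanishes on the nonempty open `U`, hence on the
   preconnected `ℝ³` (`AnalyticOnNhd.eqOn_zero_of_preconnected_of_eventuallyEq_zero`): the slice
   `t₀` is STEADY.
4. *One steady slice kills.* The proved support item `SteadySliceLiouville`
   (stmt-NavierStokesRegularity-10572, `clockStretchingLaw_steadySliceLiouville_proof`, over the
   class through `clockLaw_eq_zero_of_steady_slice`) gives `u ≡ 0` on `t < 0`.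

## References

* G. Koch, N. Nadirashvili, G. Seregin, V. Šverák, *Liouville theorems for the Navier–Stokes
  equations and applications*, Acta Math. 203 (2009) 83–105 = arXiv:0709.3599, §4.
  [KochNadirashviliSereginSverak2009]
* P. G. Lemarié-Rieusset, *The Navier–Stokes Problem in the 21st Century*, CRC Press 2016,
  Thm. 9.12 (space–time analyticity of bounded mild solutions). [LemarieRieusset2016]
* H. Dong, Q. S. Zhang, *Time analyticity for the heat equation and Navier–Stokes equations*,
  J. Funct. Anal. 279 (2020) 108563 = arXiv:1907.01687, Thm. 2. [DongZhang2020]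
-/

noncomputable section

-- the summit and its single sub-problem share the name (CONVENTIONS §1), as in every Theorems file
set_option linter.dupNamespace false

namespace Summit.NavierStokesRegularity.NavierStokesRegularity.Theorems

open Set Function Filter Topology
open Literature.Analysis Literature.Analysis.FluidPDE

section OpenSetSteadyLiouville

variable {C : ℝ} {u : ℝ → EuclideanSpace ℝ (Fin 3) → EuclideanSpace ℝ (Fin 3)}

/-- **The clock mode is the time component of the total derivative**: for a field jointly
differentiable at `(t, x)`, `∂ₜu(t,x) = D(uncurry u)(t,x)(1,0)` (chain rule along the line
`s ↦ (s, x)`, whose velocity is `(1, 0)`). -/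
theorem openSetSteadyLiouville_timeDeriv_eq_fderiv {t : ℝ} {x : EuclideanSpace ℝ (Fin 3)}
    (hd : DifferentiableAt ℝ (uncurry u) (t, x)) :
    timeDeriv u t x =
      fderiv ℝ (uncurry u) (t, x) ((1 : ℝ), (0 : EuclideanSpace ℝ (Fin 3))) := by
  rw [timeDeriv_apply]
  have hγ : HasDerivAt (fun s : ℝ => ((s, x) : ℝ × EuclideanSpace ℝ (Fin 3)))
      ((1 : ℝ), (0 : EuclideanSpace ℝ (Fin 3))) t :=
    (hasDerivAt_id t).prodMk (hasDerivAt_const t x)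
  exact (hd.hasFDerivAt.comp_hasDerivAt t hγ).deriv

/-- **The clock mode of a class element is jointly real-analytic** on the open slab
`(−∞, 0) × ℝ³`: there `∂ₜu = D(uncurry u)(·)(1,0)`
(`openSetSteadyLiouville_timeDeriv_eq_fderiv`), the Fréchet derivative of the jointly analytic
`uncurry u` (`openSetLiouville_analyticOnNhd_uncurry`) is analytic (`AnalyticOnNhd.fderiv`), and
so is its value on the fixed vector `(1, 0)` (composition with the evaluation functional
`ContinuousLinearMap.apply`). [cite: LemarieRieusset2016, Thm. 9.12 (PDF p. 260)] -/
theorem openSetSteadyLiouville_analyticOnNhd_uncurry_timeDeriv (h : IsTypeIAncientMild C u) :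
    AnalyticOnNhd ℝ (uncurry (timeDeriv u))
      (Iio 0 ×ˢ (univ : Set (EuclideanSpace ℝ (Fin 3)))) := by
  have han := openSetLiouville_analyticOnNhd_uncurry h
  have hopen : IsOpen (Iio (0 : ℝ) ×ˢ (univ : Set (EuclideanSpace ℝ (Fin 3)))) :=
    isOpen_Iio.prod isOpen_univ
  -- `z ↦ D(uncurry u)(z)(1,0)` is analytic on the slab
  have hD : AnalyticOnNhd ℝ
      (fun z : ℝ × EuclideanSpace ℝ (Fin 3) =>
        fderiv ℝ (uncurry u) z ((1 : ℝ), (0 : EuclideanSpace ℝ (Fin 3)))) (Iio 0 ×ˢ univ) :=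
    (ContinuousLinearMap.apply ℝ (EuclideanSpace ℝ (Fin 3))
      ((1 : ℝ), (0 : EuclideanSpace ℝ (Fin 3)))).comp_analyticOnNhd han.fderiv
  -- and it agrees with the clock mode there
  refine hD.congr hopen ?_
  rintro ⟨t, x⟩ hz
  exact (openSetSteadyLiouville_timeDeriv_eq_fderiv (han (t, x) hz).differentiableAt).symm

/-- **Every slice of the clock mode of a class element is real-analytic on `ℝ³`**
(`t < 0`): the slice of the jointly analytic `uncurry (∂ₜu)` (`analyticOnNhd_slice`). -/
theorem openSetSteadyLiouville_analyticOnNhd_timeDeriv_slice (h : IsTypeIAncientMild C u)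
    {t : ℝ} (ht : t < 0) : AnalyticOnNhd ℝ (timeDeriv u t) univ :=
  analyticOnNhd_slice (openSetSteadyLiouville_analyticOnNhd_uncurry_timeDeriv h) ht

/-- **No class element is locally steady**: if the clock mode `∂ₜu(t₀, ·)` of ONE slice
(`t₀ < 0`) vanishes on a nonempty open `U ⊆ ℝ³` then `u ≡ 0` on `t < 0` — the real-analytic
slice `∂ₜu(t₀, ·)` (`openSetSteadyLiouville_analyticOnNhd_timeDeriv_slice`) vanishes identically
on the preconnected `ℝ³` (identity theorem), i.e. the slice is steady, and ONE steady slice kills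
a class element (`clockLaw_eq_zero_of_steady_slice` = the proved support item
`SteadySliceLiouville`, stmt-NavierStokesRegularity-10572).
[cite: KochNadirashviliSereginSverak2009, §4 p. 8 (arXiv:0709.3599)] -/
theorem openSetSteadyLiouville (h : IsTypeIAncientMild C u) {t₀ : ℝ} (ht₀ : t₀ < 0)
    {U : Set (EuclideanSpace ℝ (Fin 3))} (hU : IsOpen U) (hne : U.Nonempty)
    (h0 : ∀ x ∈ U, timeDeriv u t₀ x = 0) : ∀ t < 0, ∀ x, u t x = 0 := by
  obtain ⟨x₀, hx₀⟩ := hne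
  have hslice : AnalyticOnNhd ℝ (timeDeriv u t₀) univ :=
    openSetSteadyLiouville_analyticOnNhd_timeDeriv_slice h ht₀
  have hev : timeDeriv u t₀ =ᶠ[𝓝 x₀] 0 := Filter.eventually_of_mem (hU.mem_nhds hx₀) h0
  have hzero := hslice.eqOn_zero_of_preconnected_of_eventuallyEq_zero isPreconnected_univ
    (mem_univ x₀) hev
  exact clockLaw_eq_zero_of_steady_slice h ht₀ fun x => hzero (mem_univ x)

end OpenSetSteadyLiouville

/-- **Stub `stub_openSetSteadyLiouville` (crux stmt-NavierStokesRegularity-10570, line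
`registered`, portrait clause in the crux's own currency `∂ₜu`)**: NO element of the Type-I
ancient mild class is LOCALLY STEADY — if `∂ₜu(t₀, ·)` vanishes on a nonempty open `U` for one
`t₀ < 0` then `u ≡ 0` on `t < 0` (joint real-analyticity of `u`, hence of `∂ₜu`; identity theorem
on the slice; the proved `SteadySliceLiouville`; `openSetSteadyLiouville`).
[cite: KochNadirashviliSereginSverak2009, §4 p. 8 (arXiv:0709.3599)] -/
theorem stub_openSetSteadyLiouville : ∀ (C : ℝ) (u : ℝ → EuclideanSpace ℝ (Fin 3) → EuclideanSpace ℝ (Fin 3)), Literature.Analysis.FluidPDE.IsTypeIAncientMild C u → ∀ (t₀ : ℝ) (U : Set (EuclideanSpace ℝ (Fin 3))), t₀ < 0 → IsOpen U → U.Nonempty → (∀ x ∈ U, Literature.Analysis.FluidPDE.timeDeriv u t₀ x = 0) → ∀ t < 0, ∀ x, u t x = 0 :=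
  fun _ _ h _ _ ht₀ hU hne h0 => openSetSteadyLiouville h ht₀ hU hne h0

end Summit.NavierStokesRegularity.NavierStokesRegularity.Theorems

end
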